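import Mathlib
import Summits.Schanuel.Schanuel.Theses.RigidCore
import Summits.Schanuel.Schanuel.Theorems.AclSubsetLogFreeCore.Negative.ExpAclField

/-!
# Crux `MinimalCounterexampleInAcl` (S*), line `kernel-arithmetic-selection` — stub 2: the pulled-back ℚ-locus of `(x, eˣ)` is `∅`-definable in `ℂ_exp`

For EVERY tuple `x : Fin n → ℂ` (no hypothesis), the set

  `locusPts x = {x' | ∀ p ∈ ℚ[X₁…Xₙ, Y₁…Yₙ], p(x, eˣ) = 0 → p(x', e^{x'}) = 0}`

of tuples `x'` such that `(x', e^{x'})` satisfies every ℚ-polynomial relation of `(x, eˣ)` is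
`∅`-definable in `ℂ_exp = (ℂ, +, ·, −, 0, 1, exp)` (`stub_locusDefinable`, registered stub of the
skeleton `Cruxes/MinimalCounterexampleInAcl/Lines/kernel-arithmetic-selection.lean`).

Proof. The relations of `(x, eˣ)` form the ideal `P_x = ker (aeval (x, eˣ)) ≤ ℚ[X, Y]`, finitely
generated by Hilbert's basis theorem (`MvPolynomial.isNoetherianRing`); since the relations of
ANY point form an ideal, `x' ∈ locusPts x` iff the finitely many generators vanish at
`(x', e^{x'})` (`locusPts_eq_biInter`). For a rational polynomial `g`, `x' ↦ g(x', e^{x'})` is an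
`∅`-definable function (`definableFun_aeval_expPoint`, by induction on `g`: rational constants
`a = num a / den a` have the `∅`-definable graph `{v | v(out) · den a = num a}`,
`definableFun_ratCast`; sums, and products with a coordinate `x'ⱼ` or `e^{x'ⱼ}`, by the tree kit
`definableFun_add'/mul'/cexp`), so `locusPts x` is a finite intersection of `∅`-definable zero
sets (`Set.definable_biInter_finset`).

## References

* [Marker2002] D. Marker, *Model Theory: An Introduction*, Springer GTM 217, §1.3 (definable sets
  are closed under finite Boolean combinations; zero sets of terms are quantifier-free definable).
* [KirbyMacintyreOnshuus2012] J. Kirby, A. Macintyre, A. Onshuus, *The algebraic numbers definable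
  in various exponential fields*, J. Inst. Math. Jussieu 11 (2012), §2 (`ℚ` is `∅`-definable in
  any exponential field of characteristic `0`).
-/

noncomputable section

open FirstOrder FirstOrder.Language Set
open Literature.ModelTheory.ExponentialFields
open Summit.Schanuel.Schanuel.Theorems.AclSubsetLogFreeCore.Negative

namespace Summit.Schanuel.Schanuel.Cruxes.MinimalCounterexampleInAcl.KernelArithmeticSelection

/-- Rational constants are `∅`-definable functions in `ℂ_exp`: the graph of `_ ↦ a` is the
`∅`-definable set `{v | v(out) * den a = num a}`. [cite: KirbyMacintyreOnshuus2012, §2] -/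
theorem definableFun_ratCast {α : Type*} (a : ℚ) :
    (∅ : Set ℂ).DefinableFun Language.expRing (fun _ : α → ℂ => (a : ℂ)) := by
  have hd : (∅ : Set ℂ).Definable Language.expRing
      {v : Option α → ℂ | v none * (a.den : ℂ) = (a.num : ℂ)} :=
    definable_setOf_eq_params
      (definableFun_mul' (definableFun_proj_params none) (definableFun_natCast' a.den))
      (definableFun_intCast' a.num)
  have hden : (a.den : ℂ) ≠ 0 := Nat.cast_ne_zero.2 a.den_nz
  have e : Function.tupleGraph (fun _ : α → ℂ => (a : ℂ)) =
      {v : Option α → ℂ | v none * (a.den : ℂ) = (a.num : ℂ)} := by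
    ext v
    simp only [Function.tupleGraph, Set.mem_setOf_eq]
    rw [Rat.cast_def, eq_comm, eq_div_iff hden]
  unfold Set.DefinableFun
  rw [e]
  exact hd

/-- The coordinates `x'ⱼ` and `e^{x'ⱼ}` of the point `(x', e^{x'})` are `∅`-definable functions of
`x'`. -/
theorem definableFun_expPoint {n : ℕ} (i : Fin n ⊕ Fin n) :
    (∅ : Set ℂ).DefinableFun Language.expRing
      (fun x' : Fin n → ℂ => Sum.elim x' (Complex.exp ∘ x') i) := by
  rcases i with j | j
  · show (∅ : Set ℂ).DefinableFun Language.expRing (fun x' : Fin n → ℂ => x' j)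
    exact definableFun_proj_params j
  · show (∅ : Set ℂ).DefinableFun Language.expRing (fun x' : Fin n → ℂ => Complex.exp (x' j))
    exact definableFun_cexp (definableFun_proj_params j)

/-- For a rational polynomial `g` in the `2n` variables `X, Y`, the map `x' ↦ g(x', e^{x'})` is an
`∅`-definable function of `x'` (induction on `g`). -/
theorem definableFun_aeval_expPoint {n : ℕ} (g : MvPolynomial (Fin n ⊕ Fin n) ℚ) :
    (∅ : Set ℂ).DefinableFun Language.expRing
      (fun x' : Fin n → ℂ => MvPolynomial.aeval (Sum.elim x' (Complex.exp ∘ x')) g) := by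
  induction g using MvPolynomial.induction_on with
  | C a => simpa using definableFun_ratCast (α := Fin n) a
  | add p q hp hq => simpa using definableFun_add' hp hq
  | mul_X p i hp => simpa using definableFun_mul' hp (definableFun_expPoint i)

/-- The zero set `{x' | g(x', e^{x'}) = 0}` of a rational polynomial `g` is `∅`-definable. -/
theorem definable_zeroSet_expPoint {n : ℕ} (g : MvPolynomial (Fin n ⊕ Fin n) ℚ) :
    (∅ : Set ℂ).Definable Language.expRing
      {x' : Fin n → ℂ | MvPolynomial.aeval (Sum.elim x' (Complex.exp ∘ x')) g = 0} :=
  definable_setOf_eq_params (definableFun_aeval_expPoint g) definableFun_zero'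

/-- If a set `G` of polynomials generates the ideal of relations of `(x, eˣ)`, then `x'` lies on the
pulled-back ℚ-locus of `(x, eˣ)` iff every member of `G` vanishes at `(x', e^{x'})` (the relations
of `(x', e^{x'})` form an ideal). -/
theorem locusPts_eq_biInter {n : ℕ} (x : Fin n → ℂ) (G : Set (MvPolynomial (Fin n ⊕ Fin n) ℚ))
    (hG : Ideal.span G =
      RingHom.ker (MvPolynomial.aeval (R := ℚ) (Sum.elim x (Complex.exp ∘ x)))) :
    {x' : Fin n → ℂ | ∀ p : MvPolynomial (Fin n ⊕ Fin n) ℚ,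
        MvPolynomial.aeval (Sum.elim x (Complex.exp ∘ x)) p = 0 →
        MvPolynomial.aeval (Sum.elim x' (Complex.exp ∘ x')) p = 0} =
      ⋂ g ∈ G, {x' : Fin n → ℂ | MvPolynomial.aeval (Sum.elim x' (Complex.exp ∘ x')) g = 0} := by
  ext x'
  simp only [Set.mem_setOf_eq, Set.mem_iInter]
  constructor
  · intro h g hg
    refine h g (RingHom.mem_ker.1 ?_)
    rw [← hG]
    exact Ideal.subset_span hg
  · intro h p hp
    have hp' : p ∈ Ideal.span G := by
      rw [hG]
      exact RingHom.mem_ker.2 hp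
    have hle : Ideal.span G ≤
        RingHom.ker (MvPolynomial.aeval (R := ℚ) (Sum.elim x' (Complex.exp ∘ x'))) :=
      Ideal.span_le.2 fun g hg => RingHom.mem_ker.2 (h g hg)
    exact RingHom.mem_ker.1 (hle hp')

/-- **Stub 2 — the pulled-back ℚ-locus is `∅`-definable, for EVERY tuple `x`.** The relations of
`(x, eˣ)` form an ideal `P_x ≤ ℚ[X, Y]` (kernel of `MvPolynomial.aeval`), finitely generated by
Hilbert's basis theorem; `x' ∈ locusPts x` iff the finitely many generators vanish at `(x', e^{x'})`,
and each such zero set is `∅`-definable, so `locusPts x` is a finite intersection of `∅`-definable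
sets. No hypothesis on `x`. [cite: Marker2002, §1.3] -/
theorem stub_locusDefinable : ∀ (n : ℕ) (x : Fin n → ℂ), (∅ : Set ℂ).Definable Literature.ModelTheory.ExponentialFields.Language.expRing {x' : Fin n → ℂ | ∀ p : MvPolynomial (Fin n ⊕ Fin n) ℚ, MvPolynomial.aeval (Sum.elim x (Complex.exp ∘ x)) p = 0 → MvPolynomial.aeval (Sum.elim x' (Complex.exp ∘ x')) p = 0} := by
  intro n x
  obtain ⟨G, hG⟩ := Ideal.fg_of_isNoetherianRing
    (RingHom.ker (MvPolynomial.aeval (R := ℚ) (Sum.elim x (Complex.exp ∘ x))))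
  rw [locusPts_eq_biInter x (↑G) hG]
  exact Set.definable_biInter_finset (fun g => definable_zeroSet_expPoint g) G

end Summit.Schanuel.Schanuel.Cruxes.MinimalCounterexampleInAcl.KernelArithmeticSelection
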